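import Literature.AlgebraicGeometry.Resolution.WeightedCentreCorollaryLF
import Literature.AlgebraicGeometry.Resolution.WeightedCentreCorollaryLFMenu
import Literature.AlgebraicGeometry.Resolution.WeightedCentreLemmaXLPin
import HarnessLib

/-!
# Weighted centres — COROLLARY L-F♮: the `V`-free form (LF-MODEL §6.4 sentence 2: ALL graded isotropies `≡ id (mod σ)`, given (P) at every class)

Instrument for engine 1's `W(f)` TOY MODEL (cell `pub-rosobs`; LF-MODEL-eng1-g45 §6.4 sentence 2 "by XL, all graded isotropies `≡ id mod σ`, fixing `ε_V` or not";
route = CARVER-NOTES-eng1-g49 §4: LEMMA XL as typed + conjugation by a unipotent graded shift of ONE heavy class, one automorphism at a time), NOT a resolution theorem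
and NOT about the invariant of [AbramovichTemkinWlodarczyk2024].  AI-written, AI-gate-reviewed.

THE STATEMENT (`ZKernel.eq_one_of_forall_slotPinned`).  `k` perfect of characteristic `p`, `n!·u_n = 1 (n < p)`, finite slot type with positive rational weights, `g` `w`-homogeneous
of weight `p(p+1)` and (P)-pinned (slot form) at EVERY slot — now INCLUDING the slots of weight `> p + 1`.  Then every `A ∈ graded w 1 ⊓ baseFixing ⊓ 𝔄_1 ⊓ Stab(C g)` (NO hypothesis
"`A = id` on `ε_V`") whose pure `σ^p`-coefficient vanishes at every slot of weight `p` is the identity; `W = ∅ ⇒` the group is `⊥`.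

PROOF (descent on the number of heavy slots `i` (`w i > p + 1`) NOT fixed by `A`).  None: COROLLARY L-F (`eq_one_of_slotPinned_of_apply_heavy`).  Else let `c` be the LARGEST weight of an
unfixed heavy slot; every slot of weight `> c` is fixed, so LEMMA XL (`LemmaXL.exists_normalForm_of_classPinned`, with `p(p+1) < p·c ⇔ p + 1 < c`, (P) at the class `c` in class form via
`SlotPinned.classPinned_killLight`) gives light `w`-homogeneous `m_v` of weight `c` with `A (C (ε_v − m_v)) = C (ε_v − m_v)` for every `v` of weight `c`.  The CLASS SHIFT
`T : ε_v ↦ ε_v + m_v (w v = c), ε_i ↦ ε_i` otherwise (`HeavyShift.constShift`, built on `AdditiveShift.shiftHom`; inverse `ε_v ↦ ε_v − m_v` because `m_v ∈ k[ε_{w < c}]`) lies in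
`graded w 1 ⊓ baseFixing`, and `A♯ := T A T⁻¹` is again in `graded w 1 ⊓ baseFixing ⊓ 𝔄_1` (`conj_mem_level`), fixes `C (τ g)` for the coordinate change `τ = aeval (ε + m)` of `k[ε]`
(`T ∘ C = C ∘ τ`), has the SAME pure `σ^p`-coefficients at the slots of weight `p` (`T` acts coefficientwise in `σ` and `τ` preserves constant terms, the `m_v` having none), fixes every
slot `A` fixed outside the class `c` AND the whole class `c`; and `τ g` is again `w`-homogeneous of weight `p(p+1)` and (P)-pinned at every slot ((P) is invariant under graded automorphism
pairs, `slotPinned_cAeval`).  So the unfixed heavy set shrinks strictly; induct; `A♯ = 1 ⇒ A = 1`.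

References: [AbramovichTemkinWlodarczyk2024, §5.1 (p. 1575), Lemma 5.2.10 (p. 1577), Thm. 5.3.1 (2)–(3) (p. 1578)]; [Lang2002, Ch. I §3, Ch. II §1, Ch. IV §1, Ch. XIII §4];
[SerreLocalFields1979, Ch. II §4 Lemma 1]; [Matsumura1987, §27 (pp. 207–209)].
-/

namespace Literature.AlgebraicGeometry.Resolution.WeightedBlowup

open Polynomial OrderFiltration LevelProjection Truncation

/-! ## The class shift `T : ε_v ↦ ε_v + q_v` by `σ`-free data, as a ring AUTOMORPHISM of `k[ε][σ]` -/

namespace HeavyShift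

open AdditiveShift

section Ring

variable {k : Type*} [CommRing k] {ι : Type*}

/-- `σ`-free shift data: the constants `C (q i)` (bookkeeping). [cite: SerreLocalFields1979, Ch. II §4 Lemma 1] -/
noncomputable def cData (q : ι → MvPolynomial ι k) : ι → (MvPolynomial ι k)[X] := fun i => C (q i)

/-- Bookkeeping. [cite: SerreLocalFields1979, Ch. II §4 Lemma 1] -/
theorem cData_apply (q : ι → MvPolynomial ι k) (i : ι) : cData q i = C (q i) := rfl

/-- Bookkeeping. [cite: SerreLocalFields1979, Ch. II §4 Lemma 1] -/
theorem neg_cData (q : ι → MvPolynomial ι k) : -cData q = cData (-q) :=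
  funext fun i => by rw [Pi.neg_apply, cData_apply, cData_apply, Pi.neg_apply, map_neg]

/-- A constant whose variables lie in `U` is over `U` (bookkeeping). [cite: SerreLocalFields1979, Ch. II §4 Lemma 1] -/
theorem isOver_C {U : Set ι} {a : MvPolynomial ι k} (h : ∀ j ∈ a.vars, j ∈ U) : IsOver U (C a : (MvPolynomial ι k)[X]) := fun s j hj => by
  rw [coeff_C] at hj
  split_ifs at hj with hs
  · exact h j hj
  · rw [MvPolynomial.vars_0] at hj
    exact absurd hj (Finset.notMem_empty j)

/-- The coordinate change `τ_q : ε_i ↦ ε_i + q_i` of `k[ε]` (bookkeeping). [cite: Lang2002, Ch. IV §1] -/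
noncomputable def cAeval (q : ι → MvPolynomial ι k) : MvPolynomial ι k →ₐ[k] MvPolynomial ι k :=
  MvPolynomial.aeval fun i => MvPolynomial.X i + q i

/-- Bookkeeping. [cite: Lang2002, Ch. IV §1] -/
theorem cAeval_X (q : ι → MvPolynomial ι k) (i : ι) : cAeval q (MvPolynomial.X i) = MvPolynomial.X i + q i := by
  rw [cAeval, MvPolynomial.aeval_X]

/-- **The shift by `σ`-free data acts through `C` by the coordinate change `τ_q`**: `Φ_{C q} (C a) = C (τ_q a)` (bookkeeping). [cite: SerreLocalFields1979, Ch. II §4 Lemma 1; Lang2002, Ch. IV §1] -/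
theorem shiftHom_cData_C (q : ι → MvPolynomial ι k) (a : MvPolynomial ι k) : shiftHom (cData q) (C a) = C (cAeval q a) := by
  have key : (shiftHom (cData q)).comp C = (C : MvPolynomial ι k →+* (MvPolynomial ι k)[X]).comp (cAeval q).toRingHom :=
    MvPolynomial.ringHom_ext
      (fun c => by
        rw [RingHom.comp_apply, RingHom.comp_apply, shiftHom_C_C, AlgHom.toRingHom_eq_coe, RingHom.coe_coe, cAeval, MvPolynomial.aeval_C,
          MvPolynomial.algebraMap_eq])
      (fun i => by
        rw [RingHom.comp_apply, RingHom.comp_apply, shiftHom_C_X, cData_apply, AlgHom.toRingHom_eq_coe, RingHom.coe_coe, cAeval_X, map_add])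
  exact RingHom.congr_fun key a

/-- … hence coefficientwise in `σ`: `Φ_{C q} F = F.map τ_q` (bookkeeping). [cite: SerreLocalFields1979, Ch. II §4 Lemma 1; Lang2002, Ch. IV §1] -/
theorem shiftHom_cData_eq_map (q : ι → MvPolynomial ι k) (F : (MvPolynomial ι k)[X]) : shiftHom (cData q) F = F.map (cAeval q).toRingHom := by
  have key : shiftHom (cData q) = mapRingHom (cAeval q).toRingHom :=
    Polynomial.ringHom_ext' (RingHom.ext fun a => by rw [RingHom.comp_apply, RingHom.comp_apply, shiftHom_cData_C, coe_mapRingHom, map_C, AlgHom.toRingHom_eq_coe,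
      RingHom.coe_coe]) (by rw [shiftHom_X, coe_mapRingHom, map_X])
  rw [key, coe_mapRingHom]

/-- `τ_q` preserves constant terms when the `q_i` have none (bookkeeping). [cite: Lang2002, Ch. IV §1] -/
theorem constantCoeff_cAeval {q : ι → MvPolynomial ι k} (hq0 : ∀ i, MvPolynomial.constantCoeff (q i) = 0) (a : MvPolynomial ι k) :
    MvPolynomial.constantCoeff (cAeval q a) = MvPolynomial.constantCoeff a := by
  have key : MvPolynomial.constantCoeff.comp (cAeval q).toRingHom = (MvPolynomial.constantCoeff : MvPolynomial ι k →+* k) :=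
    MvPolynomial.ringHom_ext
      (fun c => by rw [RingHom.comp_apply, AlgHom.toRingHom_eq_coe, RingHom.coe_coe, cAeval, MvPolynomial.aeval_C, MvPolynomial.algebraMap_eq])
      (fun i => by rw [RingHom.comp_apply, AlgHom.toRingHom_eq_coe, RingHom.coe_coe, cAeval_X, map_add, hq0 i, add_zero])
  exact RingHom.congr_fun key a

variable [DecidableEq ι]

/-- **The class shift as a ring automorphism**: for `σ`-free data `q` vanishing on `U` and with every `q_i ∈ k[ε_U]`, `T_q := Φ_{C q}` with inverse `Φ_{−C q}` (LEMMA G,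
`AdditiveShift.shiftHom_neg_comp`).  Instrument for engine 1's `W(f)` toy model. [cite: SerreLocalFields1979, Ch. II §4 Lemma 1; Lang2002, Ch. IV §1] -/
noncomputable def constShift (U : Set ι) (q : ι → MvPolynomial ι k) (h0 : ∀ u ∈ U, q u = 0) (hover : ∀ x, ∀ j ∈ (q x).vars, j ∈ U) :
    (MvPolynomial ι k)[X] ≃+* (MvPolynomial ι k)[X] :=
  RingEquiv.ofRingHom (shiftHom (cData q)) (shiftHom (cData (-q)))
    (by
      have h := shiftHom_neg_comp (U := U) (P := cData (-q)) (fun u hu => by rw [cData_apply, Pi.neg_apply, h0 u hu, neg_zero, map_zero])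
        (fun x => isOver_C fun j hj => hover x j (by rwa [Pi.neg_apply, MvPolynomial.vars_neg] at hj))
      rwa [neg_cData, neg_neg] at h)
    (by
      have h := shiftHom_neg_comp (U := U) (P := cData q) (fun u hu => by rw [cData_apply, h0 u hu, map_zero]) (fun x => isOver_C (hover x))
      rwa [neg_cData] at h)

variable {U : Set ι} {q : ι → MvPolynomial ι k} (h0 : ∀ u ∈ U, q u = 0) (hover : ∀ x, ∀ j ∈ (q x).vars, j ∈ U)

/-- Bookkeeping. [cite: SerreLocalFields1979, Ch. II §4 Lemma 1] -/
theorem coe_constShift : ((constShift U q h0 hover : (MvPolynomial ι k)[X] ≃+* (MvPolynomial ι k)[X]) : (MvPolynomial ι k)[X] →+* (MvPolynomial ι k)[X]) =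
    shiftHom (cData q) := rfl

/-- Bookkeeping. [cite: SerreLocalFields1979, Ch. II §4 Lemma 1] -/
theorem coe_constShift_symm : (((constShift U q h0 hover).symm : (MvPolynomial ι k)[X] ≃+* (MvPolynomial ι k)[X]) : (MvPolynomial ι k)[X] →+* (MvPolynomial ι k)[X]) =
    shiftHom (cData (-q)) := rfl

/-- Bookkeeping. [cite: SerreLocalFields1979, Ch. II §4 Lemma 1] -/
theorem constShift_apply (y : (MvPolynomial ι k)[X]) : constShift U q h0 hover y = shiftHom (cData q) y := rfl

/-- Bookkeeping. [cite: SerreLocalFields1979, Ch. II §4 Lemma 1] -/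
theorem constShift_symm_apply (y : (MvPolynomial ι k)[X]) : (constShift U q h0 hover).symm y = shiftHom (cData (-q)) y := rfl

/-- `T_q σ = σ` (bookkeeping). [cite: SerreLocalFields1979, Ch. II §4 Lemma 1] -/
theorem constShift_X : constShift U q h0 hover (X : (MvPolynomial ι k)[X]) = X := shiftHom_X _

/-- `T_q` fixes the scalars (bookkeeping). [cite: SerreLocalFields1979, Ch. II §4 Lemma 1] -/
theorem constShift_C_C (c : k) : constShift U q h0 hover (C (MvPolynomial.C c)) = C (MvPolynomial.C c) := shiftHom_C_C _ c

/-- `T_q (C ε_i) = C (ε_i + q_i)` (bookkeeping). [cite: SerreLocalFields1979, Ch. II §4 Lemma 1] -/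
theorem constShift_C_X (i : ι) : constShift U q h0 hover (C (MvPolynomial.X i)) = C (MvPolynomial.X i + q i) := by
  rw [constShift_apply, shiftHom_C_X, cData_apply, map_add]

/-- `T_q⁻¹ (C ε_i) = C (ε_i − q_i)` (bookkeeping). [cite: SerreLocalFields1979, Ch. II §4 Lemma 1] -/
theorem constShift_symm_C_X (i : ι) : (constShift U q h0 hover).symm (C (MvPolynomial.X i)) = C (MvPolynomial.X i - q i) := by
  rw [constShift_symm_apply, shiftHom_C_X, cData_apply, Pi.neg_apply, map_neg, ← sub_eq_add_neg, ← map_sub]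

/-- `T_q (C a) = C (τ_q a)` (bookkeeping). [cite: SerreLocalFields1979, Ch. II §4 Lemma 1; Lang2002, Ch. IV §1] -/
theorem constShift_C (a : MvPolynomial ι k) : constShift U q h0 hover (C a) = C (cAeval q a) := shiftHom_cData_C q a

/-- `T_q⁻¹ (C a) = C (τ_{−q} a)` (bookkeeping). [cite: SerreLocalFields1979, Ch. II §4 Lemma 1; Lang2002, Ch. IV §1] -/
theorem constShift_symm_C (a : MvPolynomial ι k) : (constShift U q h0 hover).symm (C a) = C (cAeval (-q) a) := shiftHom_cData_C (-q) a

/-- `T_q` fixes every constant over `U` (bookkeeping: `Φ_P` fixes `k[ε_U][σ]`). [cite: SerreLocalFields1979, Ch. II §4 Lemma 1] -/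
theorem constShift_C_of_vars {a : MvPolynomial ι k} (ha : ∀ j ∈ a.vars, j ∈ U) : constShift U q h0 hover (C a) = C a :=
  (isShiftBy_shiftHom (U := U) (P := cData q) (fun u hu => by rw [cData_apply, h0 u hu, map_zero]) fun x => isOver_C (hover x)).apply_eq_self (isOver_C ha)

/-- `T_q ∈ baseFixing` (bookkeeping). [cite: Lang2002, Ch. IV §1] -/
theorem constShift_mem_baseFixing : constShift U q h0 hover ∈ baseFixing := ⟨constShift_X h0 hover, constShift_C_C h0 hover⟩

include h0 hover in
/-- `τ_{−q} ∘ τ_q = id` (bookkeeping, read off `T_q⁻¹ ∘ T_q = id` through the injectivity of `C`). [cite: SerreLocalFields1979, Ch. II §4 Lemma 1; Lang2002, Ch. IV §1] -/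
theorem cAeval_neg_cAeval (a : MvPolynomial ι k) : cAeval (-q) (cAeval q a) = a := by
  apply Polynomial.C_injective
  rw [← constShift_symm_C h0 hover, ← constShift_C h0 hover, RingEquiv.symm_apply_apply]

include h0 hover in
/-- `τ_q ∘ τ_{−q} = id` (bookkeeping). [cite: SerreLocalFields1979, Ch. II §4 Lemma 1; Lang2002, Ch. IV §1] -/
theorem cAeval_cAeval_neg (a : MvPolynomial ι k) : cAeval q (cAeval (-q) a) = a := by
  apply Polynomial.C_injective
  rw [← constShift_C h0 hover, ← constShift_symm_C h0 hover, RingEquiv.apply_symm_apply]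

section Graded

variable {w : ι → ℚ} (hq : ∀ i, MvPolynomial.IsWeightedHomogeneous w (q i) (w i))
include hq

/-- **The class shift is graded** when every `q_i` is `w`-homogeneous of weight `w i` (bookkeeping, `AdditiveShift.isGradedHom_shiftHom`). [cite: AbramovichTemkinWlodarczyk2024, Thm. 5.3.1 (2)–(3) (p. 1578)] -/
theorem constShift_mem_graded (ρ : ℚ) : constShift U q h0 hover ∈ graded w ρ := by
  refine ⟨?_, ?_⟩
  · rw [coe_constShift]
    exact isGradedHom_shiftHom fun x => isTW_C (hq x)
  · rw [coe_constShift_symm]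
    exact isGradedHom_shiftHom fun x => isTW_C ((MvPolynomial.weightedHomogeneousSubmodule k w (w x)).neg_mem (hq x))

omit [DecidableEq ι] in
/-- `τ_q` is graded (bookkeeping). [cite: AbramovichTemkinWlodarczyk2024, §5.1 (p. 1575)] -/
theorem isGraded_cAeval : IsGraded w (cAeval q) := fun i => by
  rw [cAeval_X]
  exact (MvPolynomial.isWeightedHomogeneous_X k w i).add (hq i)

include h0 hover in
/-- `(τ_q, τ_{−q})` is a graded automorphism pair of `k[ε]` (bookkeeping). [cite: AbramovichTemkinWlodarczyk2024, §5.1 (p. 1575)] -/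
theorem isGradedAutPair_cAeval : IsGradedAutPair w (cAeval q) (cAeval (-q)) :=
  ⟨isGraded_cAeval hq, fun i => by
      rw [cAeval_X, Pi.neg_apply]
      exact (MvPolynomial.isWeightedHomogeneous_X k w i).add ((MvPolynomial.weightedHomogeneousSubmodule k w (w i)).neg_mem (hq i)),
    cAeval_cAeval_neg h0 hover, cAeval_neg_cAeval h0 hover⟩

include h0 hover in
/-- `τ_q g` is `w`-homogeneous of the same weight as `g` (bookkeeping, through the graded `T_q`). [cite: AbramovichTemkinWlodarczyk2024, Thm. 5.3.1 (2)–(3) (p. 1578)] -/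
theorem isWeightedHomogeneous_cAeval {g : MvPolynomial ι k} {μ : ℚ} (hg : MvPolynomial.IsWeightedHomogeneous w g μ) :
    MvPolynomial.IsWeightedHomogeneous w (cAeval q g) μ := by
  have h := ((constShift_mem_graded h0 hover hq (1 : ℚ)).1.isTW_map_C hg) 0
  rwa [zero_smul, sub_zero, RingHom.coe_coe, constShift_C, coeff_C_zero] at h

end Graded

end Ring

section OverField

variable {L : Type*} [Field L] {ι : Type*} [DecidableEq ι] {U : Set ι} {q : ι → MvPolynomial ι L} (h0 : ∀ u ∈ U, q u = 0) (hover : ∀ x, ∀ j ∈ (q x).vars, j ∈ U)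
  {w : ι → ℚ} (hq : ∀ i, MvPolynomial.IsWeightedHomogeneous w (q i) (w i))
include h0 hover hq

/-- **(P) is invariant under the coordinate change `τ_q`**: `SlotPinned w l g → SlotPinned w l (τ_q g)` (compose the test pair with `(τ_q, τ_{−q})`; bookkeeping).
[cite: AbramovichTemkinWlodarczyk2024, §5.1 (p. 1575)] -/
theorem slotPinned_cAeval {l : ι} {g : MvPolynomial ι L} (hl : SlotPinned w l g) : SlotPinned w l (cAeval q g) := fun Φ Φ' hΦ => by
  have h := hl _ _ (hΦ.comp w (isGradedAutPair_cAeval h0 hover hq))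
  rwa [AlgHom.comp_apply] at h

end OverField


end HeavyShift

/-! ## COROLLARY L-F♮ -/

namespace ZKernel

open HeavyShift

universe uk ui

variable {k : Type uk} [Field k] (p : ℕ) [Fact p.Prime] [CharP k p] {u : ℕ → k}

/-- COROLLARY L-F♮ with a bound on the number of unfixed heavy slots — the descent behind `eq_one_of_forall_slotPinned` (each step: LEMMA XL at the largest unfixed heavy weight `c`,
then conjugation by the class shift `T`; base: COROLLARY L-F).  Instrument for engine 1's `W(f)` toy model, NOT a resolution theorem.
[cite: AbramovichTemkinWlodarczyk2024, §5.1 (p. 1575), Lemma 5.2.10 (p. 1577), Thm. 5.3.1 (2)–(3) (p. 1578); Lang2002, Ch. I §3, Ch. IV §1, Ch. XIII §4; SerreLocalFields1979, Ch. II §4 Lemma 1] -/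
theorem eq_one_of_forall_slotPinned_of_ncard_le (hperf : ∀ x : k, ∃ y : k, y ^ p = x) (hu : ∀ n < p, (Nat.factorial n : k) * u n = 1)
    {ι : Type ui} [Fintype ι] [DecidableEq ι] {w : ι → ℚ} (hw : ∀ i, 0 < w i) (n : ℕ) :
    ∀ {g : MvPolynomial ι k}, MvPolynomial.IsWeightedHomogeneous w g ((p : ℚ) * (p + 1)) → (∀ l, SlotPinned w l g) →
      ∀ {A : (MvPolynomial ι k)[X] ≃+* (MvPolynomial ι k)[X]}, A ∈ graded w (1 : ℚ) → A ∈ baseFixing → A ∈ level (X : (MvPolynomial ι k)[X]) 1 → A (C g) = C g →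
        (∀ m, w m = p → pureCoeff (A : (MvPolynomial ι k)[X] →+* (MvPolynomial ι k)[X]) m p = 0) →
        {i : ι | (p : ℚ) + 1 < w i ∧ A (C (MvPolynomial.X i)) ≠ C (MvPolynomial.X i)}.ncard ≤ n → A = 1 := by
  have hp : 1 < p := (Fact.out : p.Prime).one_lt
  have hp0 : (0 : ℚ) < p := by exact_mod_cast (Fact.out : p.Prime).pos
  induction n with
  | zero =>
    intro g hg hP A hgr hb h1 hfix hW hcard
    have hS : {i : ι | (p : ℚ) + 1 < w i ∧ A (C (MvPolynomial.X i)) ≠ C (MvPolynomial.X i)} = ∅ := (Set.ncard_eq_zero (Set.toFinite _)).mp (Nat.le_zero.mp hcard)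
    refine eq_one_of_slotPinned_of_apply_heavy p hperf hu hw hg (fun l _ => hP l) hgr hb h1 (fun j hj => ?_) hfix hW
    by_contra hne
    exact (Set.eq_empty_iff_forall_notMem.mp hS) j ⟨hj, hne⟩
  | succ n ih =>
    intro g hg hP A hgr hb h1 hfix hW hcard
    set S : Set ι := {i : ι | (p : ℚ) + 1 < w i ∧ A (C (MvPolynomial.X i)) ≠ C (MvPolynomial.X i)} with hSdef
    by_cases hSe : S = ∅
    · refine eq_one_of_slotPinned_of_apply_heavy p hperf hu hw hg (fun l _ => hP l) hgr hb h1 (fun j hj => ?_) hfix hW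
      by_contra hne
      exact (Set.eq_empty_iff_forall_notMem.mp hSe) j ⟨hj, hne⟩
    -- the largest unfixed heavy weight `c`
    obtain ⟨v, hvS, hvmax⟩ := Set.exists_max_image S w (Set.toFinite _) (Set.nonempty_iff_ne_empty.mpr hSe)
    set c : ℚ := w v with hcdef
    have hvc : (p : ℚ) + 1 < c := hvS.1
    have hc0 : 0 < c := by linarith
    have hcp : (p : ℚ) ≠ c := by linarith
    have hAfix : ∀ i, c < w i → A (C (MvPolynomial.X i)) = C (MvPolynomial.X i) := fun i hi => by
      by_contra hne
      exact absurd (hvmax i ⟨by linarith, hne⟩) (not_le.mpr hi)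
    -- LEMMA XL at the class `c`
    obtain ⟨m, hm⟩ := LemmaXL.exists_normalForm_of_classPinned p (ρ := (1 : ℚ)) (μ := (p : ℚ) * (p + 1)) (c := c)
      (Φ := (A : (MvPolynomial ι k)[X] →+* (MvPolynomial ι k)[X])) hgr.1 (isIdModSigma_of_mem_level_one h1) (fun i hi => hAfix i hi) hw one_pos hc0
      (g := g) hfix (by nlinarith) (hg.killLight _)
      (fun V hV => by have h := (hP V).classPinned_killLight w hw; rw [hV] at h; exact h)
    -- the shift data
    let q : ι → MvPolynomial ι k := fun i => if w i = c then m i else 0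
    have hqc : ∀ i, w i = c → q i = m i := fun i hi => if_pos hi
    have h0 : ∀ i ∈ ({i | w i ≠ c} : Set ι), q i = 0 := fun i hi => if_neg hi
    have hmU : ∀ x, w x = c → ∀ j ∈ (m x).vars, j ∈ ({i | w i ≠ c} : Set ι) := fun x hx j hj =>
      ne_of_lt ((hm x hx).2.1.lt_of_mem_vars hj)
    have hover : ∀ x, ∀ j ∈ (q x).vars, j ∈ ({i | w i ≠ c} : Set ι) := fun x j hj => by
      by_cases hx : w x = c
      · rw [hqc x hx] at hj
        exact hmU x hx j hj
      · rw [h0 x hx, MvPolynomial.vars_0] at hj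
        exact absurd hj (Finset.notMem_empty j)
    have hq : ∀ i, MvPolynomial.IsWeightedHomogeneous w (q i) (w i) := fun i => by
      by_cases hi : w i = c
      · rw [hqc i hi, hi]; exact (hm i hi).1
      · rw [h0 i hi]; exact MvPolynomial.isWeightedHomogeneous_zero _ _ _
    have hq0 : ∀ i, MvPolynomial.constantCoeff (q i) = 0 := fun i => by
      by_cases hi : w i = c
      · rw [hqc i hi, MvPolynomial.constantCoeff_eq]
        exact (hm i hi).1.coeff_eq_zero 0 (by rw [map_zero]; exact hc0.ne)
      · rw [h0 i hi, map_zero]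
    -- the class shift `T` and the conjugate `A♯ = T A T⁻¹`
    let T : (MvPolynomial ι k)[X] ≃+* (MvPolynomial ι k)[X] := constShift {i | w i ≠ c} q h0 hover
    have hTgr : T ∈ graded w (1 : ℚ) := constShift_mem_graded h0 hover hq 1
    have hTb : T ∈ baseFixing := constShift_mem_baseFixing h0 hover
    have hTiX : ∀ i, w i ≠ c → T⁻¹ (C (MvPolynomial.X i)) = C (MvPolynomial.X i) := fun i hi => by
      rw [RingAut.inv_apply, constShift_symm_C_X, h0 i hi, sub_zero]
    have hTX : ∀ i, w i ≠ c → T (C (MvPolynomial.X i)) = C (MvPolynomial.X i) := fun i hi => by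
      rw [constShift_C_X, h0 i hi, add_zero]
    set A' : (MvPolynomial ι k)[X] ≃+* (MvPolynomial ι k)[X] := T * A * T⁻¹ with hA'def
    have hA'gr : A' ∈ graded w (1 : ℚ) := Subgroup.mul_mem _ (Subgroup.mul_mem _ hTgr hgr) (Subgroup.inv_mem _ hTgr)
    have hA'b : A' ∈ baseFixing := Subgroup.mul_mem _ (Subgroup.mul_mem _ hTb hb) (Subgroup.inv_mem _ hTb)
    have hA'1 : A' ∈ level (X : (MvPolynomial ι k)[X]) 1 := OrderFiltration.conj_mem_level (constShift_X h0 hover) h1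
    have hA'fix : A' (C (cAeval q g)) = C (cAeval q g) := by
      rw [← constShift_C h0 hover, hA'def, RingAut.mul_apply, RingAut.mul_apply, RingAut.inv_apply, RingEquiv.symm_apply_apply, hfix]
    have hA'W : ∀ m₀, w m₀ = p → pureCoeff (A' : (MvPolynomial ι k)[X] →+* (MvPolynomial ι k)[X]) m₀ p = 0 := fun m₀ hm₀ => by
      have hm₀c : w m₀ ≠ c := by rw [hm₀]; exact hcp
      have h := hW m₀ hm₀
      unfold pureCoeff at h ⊢
      rw [RingHom.coe_coe] at h
      rw [RingHom.coe_coe, hA'def, RingAut.mul_apply, RingAut.mul_apply, hTiX m₀ hm₀c, constShift_apply, shiftHom_cData_eq_map, coeff_map,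
        AlgHom.toRingHom_eq_coe, RingHom.coe_coe, ← MvPolynomial.constantCoeff_eq, constantCoeff_cAeval hq0, MvPolynomial.constantCoeff_eq, h]
    -- `A♯` fixes the class `c` and every slot `A` fixes
    have hA'c : ∀ i, w i = c → A' (C (MvPolynomial.X i)) = C (MvPolynomial.X i) := fun i hi => by
      have h3 := (hm i hi).2.2
      rw [RingHom.coe_coe] at h3
      rw [hA'def, RingAut.mul_apply, RingAut.mul_apply, RingAut.inv_apply, constShift_symm_C_X, hqc i hi, h3,
        map_sub (C : MvPolynomial ι k →+* (MvPolynomial ι k)[X]), map_sub T, constShift_C_X, hqc i hi, constShift_C_of_vars h0 hover (hmU i hi), map_add,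
        add_sub_cancel_right]
    have hA'i : ∀ i, w i ≠ c → A (C (MvPolynomial.X i)) = C (MvPolynomial.X i) → A' (C (MvPolynomial.X i)) = C (MvPolynomial.X i) := fun i hi hAi => by
      rw [hA'def, RingAut.mul_apply, RingAut.mul_apply, hTiX i hi, hAi, hTX i hi]
    -- the unfixed heavy set shrinks strictly
    have hsub : {i : ι | (p : ℚ) + 1 < w i ∧ A' (C (MvPolynomial.X i)) ≠ C (MvPolynomial.X i)} ⊂ S := by
      refine ⟨fun i hi => ⟨hi.1, fun hAi => ?_⟩, fun h => ?_⟩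
      · by_cases hic : w i = c
        · exact hi.2 (hA'c i hic)
        · exact hi.2 (hA'i i hic hAi)
      · exact (h hvS).2 (hA'c v rfl)
    have hcard' : {i : ι | (p : ℚ) + 1 < w i ∧ A' (C (MvPolynomial.X i)) ≠ C (MvPolynomial.X i)}.ncard ≤ n := by
      have hlt := Set.ncard_lt_ncard hsub (Set.toFinite _)
      omega
    -- induction and unwinding the conjugation
    have hA'1' : A' = 1 := ih (isWeightedHomogeneous_cAeval h0 hover hq hg) (fun l => slotPinned_cAeval h0 hover hq (hP l)) hA'gr hA'b hA'1 hA'fix hA'W hcard'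
    have hTA : T * A = T := mul_inv_eq_iff_eq_mul.mp hA'1' |>.trans (one_mul T)
    exact mul_left_cancel (hTA.trans (mul_one T).symm)

/-- **COROLLARY L-F♮ — the `V`-free form** (LF-MODEL-eng1-g45 §6.4 sentence 2; `k` perfect of characteristic `p`, `n!·u_n = 1 (n < p)`, positive rational weights, `g` `w`-homogeneous of
weight `p(p+1)`, (P) at EVERY slot incl. the classes of weight `> p + 1`): every `A ∈ graded w 1 ⊓ baseFixing ⊓ 𝔄_1 ⊓ Stab(C g)` — graded `k[σ]`-automorphism `≡ id (mod σ)` fixing `g`,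
fixing `ε_V` OR NOT — without pure `σ^p`-term on the slots of weight `p` is the identity.  Proof: `eq_one_of_forall_slotPinned_of_ncard_le` (XL + class-shift conjugation down to COROLLARY L-F).
Instrument for engine 1's `W(f)` toy model, NOT a resolution theorem, NOT about the invariant of [AbramovichTemkinWlodarczyk2024].
[cite: AbramovichTemkinWlodarczyk2024, §5.1 (p. 1575), Lemma 5.2.10 (p. 1577), Thm. 5.3.1 (2)–(3) (p. 1578); Lang2002, Ch. I §3, Ch. IV §1, Ch. XIII §4; Matsumura1987, §27 (pp. 207–209)] -/
theorem eq_one_of_forall_slotPinned (hperf : ∀ x : k, ∃ y : k, y ^ p = x) (hu : ∀ n < p, (Nat.factorial n : k) * u n = 1)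
    {ι : Type ui} [Fintype ι] [DecidableEq ι] {w : ι → ℚ} (hw : ∀ i, 0 < w i)
    {g : MvPolynomial ι k} (hg : MvPolynomial.IsWeightedHomogeneous w g ((p : ℚ) * (p + 1))) (hP : ∀ l, SlotPinned w l g)
    {A : (MvPolynomial ι k)[X] ≃+* (MvPolynomial ι k)[X]} (hgr : A ∈ graded w (1 : ℚ)) (hb : A ∈ baseFixing) (h1 : A ∈ level (X : (MvPolynomial ι k)[X]) 1)
    (hfix : A (C g) = C g) (hW : ∀ m, w m = p → pureCoeff (A : (MvPolynomial ι k)[X] →+* (MvPolynomial ι k)[X]) m p = 0) : A = 1 :=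
  eq_one_of_forall_slotPinned_of_ncard_le p hperf hu hw _ hg hP hgr hb h1 hfix hW le_rfl

/-- **COROLLARY L-F♮, group form**: under the hypotheses of `eq_one_of_forall_slotPinned` with NO slot of weight `p` (`W = ∅`), `graded w 1 ⊓ baseFixing ⊓ 𝔄_1 ⊓ Stab(C g) = ⊥` — the
graded `k[σ]`-isotropy group of `g` `≡ id (mod σ)` is trivial.  Instrument for engine 1's `W(f)` toy model, NOT a resolution theorem.
[cite: AbramovichTemkinWlodarczyk2024, Thm. 5.3.1 (2)–(3) (p. 1578); Lang2002, Ch. I §3, Ch. XIII §4] -/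
theorem inf_stabilizer_eq_bot_of_forall_slotPinned (hperf : ∀ x : k, ∃ y : k, y ^ p = x) (hu : ∀ n < p, (Nat.factorial n : k) * u n = 1)
    {ι : Type ui} [Fintype ι] [DecidableEq ι] {w : ι → ℚ} (hw : ∀ i, 0 < w i) (hWe : ∀ m, w m ≠ p)
    {g : MvPolynomial ι k} (hg : MvPolynomial.IsWeightedHomogeneous w g ((p : ℚ) * (p + 1))) (hP : ∀ l, SlotPinned w l g) :
    graded (k := k) w (1 : ℚ) ⊓ baseFixing ⊓ level (X : (MvPolynomial ι k)[X]) 1 ⊓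
        MulAction.stabilizer ((MvPolynomial ι k)[X] ≃+* (MvPolynomial ι k)[X]) (C g : (MvPolynomial ι k)[X]) = ⊥ :=
  (Subgroup.eq_bot_iff_forall _).mpr fun _ hA =>
    eq_one_of_forall_slotPinned p hperf hu hw hg hP hA.1.1.1 hA.1.1.2 hA.1.2 (MulAction.mem_stabilizer_iff.mp hA.2) fun m hm => absurd hm (hWe m)

/-- **COROLLARY L-F♮ in engine 1's menu language**: given (P) at EVERY slot, `NoPureWTermImpliesTrivial p w V g` holds for EVERY `V` — the `fixSlots V` conjunct of `Iso(N, g)` is simply not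
used (`eq_one_of_forall_slotPinned`).  Instrument for engine 1's `W(f)` toy model, NOT a resolution theorem. [cite: AbramovichTemkinWlodarczyk2024, §5.1 (p. 1575), Thm. 5.3.1 (2)–(3) (p. 1578)] -/
theorem noPureWTermImpliesTrivial_of_forall_slotPinned (hperf : ∀ x : k, ∃ y : k, y ^ p = x) (hu : ∀ n < p, (Nat.factorial n : k) * u n = 1)
    {ι : Type ui} [Fintype ι] [DecidableEq ι] {w : ι → ℚ} (hw : ∀ i, 0 < w i)
    {g : MvPolynomial ι k} (hg : MvPolynomial.IsWeightedHomogeneous w g ((p : ℚ) * (p + 1))) (hP : ∀ l, SlotPinned w l g) (V : Set ι) :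
    NoPureWTermImpliesTrivial p w V g := fun A hA hW => by
  obtain ⟨hgr, hb, h1, -, hfix⟩ := mem_isoGroup.mp hA
  exact eq_one_of_forall_slotPinned p hperf hu hw hg hP hgr hb h1 hfix hW

/-- … and with NO slot of weight `p`, `Iso(N, g) = ⊥` for EVERY `V`, in particular for `V = ∅` (no slot required fixed).  Instrument for engine 1's `W(f)` toy model, NOT a resolution theorem.
[cite: AbramovichTemkinWlodarczyk2024, Thm. 5.3.1 (2)–(3) (p. 1578); Lang2002, Ch. I §3] -/
theorem isoGroup_eq_bot_of_forall_slotPinned (hperf : ∀ x : k, ∃ y : k, y ^ p = x) (hu : ∀ n < p, (Nat.factorial n : k) * u n = 1)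
    {ι : Type ui} [Fintype ι] [DecidableEq ι] {w : ι → ℚ} (hw : ∀ i, 0 < w i) (hWe : ∀ m, w m ≠ p)
    {g : MvPolynomial ι k} (hg : MvPolynomial.IsWeightedHomogeneous w g ((p : ℚ) * (p + 1))) (hP : ∀ l, SlotPinned w l g) (V : Set ι) :
    isoGroup w V g = ⊥ :=
  (Subgroup.eq_bot_iff_forall _).mpr fun A hA => noPureWTermImpliesTrivial_of_forall_slotPinned p hperf hu hw hg hP V A hA fun m hm => absurd hm (hWe m)

end ZKernel

end Literature.AlgebraicGeometry.Resolution.WeightedBlowup
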